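import Summits.AtomisticToContinuum.HydrodynamicLimit.Theorems.InformationPercolationEngineChaosClosesEulerLocalEquilibriumFromDissipationB
import HarnessLib

/-!
# Pointwise local equilibrium from the empirical H-theorem (crux `ChaosClosesEuler`, stmt-AtomisticToContinuum-15141,
# line `empirical-h-theorem`, stub `stub_localEquilibriumFromDissipation`) — helper C: the cone law as a measure

WHAT. The `x`-cone velocity law of ONE configuration `w` of `N + 1` particles,
`coneLaw r w x = Σᵢ (N+1)⁻¹ b_r(xᵢ, x) δ_{vᵢ}` (a finite measure on `V3`), and its identification lemmas: integration
against it is the cone-weighted empirical average (`integral_coneLaw_real`), so that its mass, momentum, energy,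
`ψ`-moments, tails and `δ`-mollification are DEFINITIONALLY the tree's `rhoC`, `momC`, `kinC`, `MpsiC`,
`MpsiC (sqTail M)` and the `gC` of helper A.  Consequently (`dr_coneLaw`) the hypothesis `DissipationRigidity` of the
statement (VERBATIM, a statement about all finite measures `m` on `V3`), applied to `m := coneLaw r w x`, reads: on the
class `ρ₁ ≤ ρ_r(x) ≤ ρ₂`, cone tails below the modulus, `θ_r(x) ≥ θ₁`, a small cut dissipation `DissC ≤ η` of the
smoothed cone law forces `|M_ψ − ρ_r ∫ψ M_{1,θ_r,u_r}| ≤ ε`.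

References: elementary measure theory (finite sums of Dirac masses). No named fact is invoked.
-/

noncomputable section

namespace Summit.AtomisticToContinuum.HydrodynamicLimit.Theorems.ChaosClosesEulerLocalEquilibriumFromDissipation

open scoped BigOperators Topology Classical MeasureTheory ENNReal InnerProductSpace
open Filter Set MeasureTheory Function
open Literature.MathematicalPhysics.KineticTheory
open Literature.Analysis.FluidPDE
open Summit.AtomisticToContinuum.HydrodynamicLimit.Theorems.LocalSecondLawNegative
open Summit.AtomisticToContinuum.HydrodynamicLimit.Theorems.LocalSecondLawLedger
open Summit.AtomisticToContinuum.HydrodynamicLimit.Theorems.LocalSecondLawLedger.L (rhoC_eq_sum momC_eq_sum)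
open Summit.AtomisticToContinuum.HydrodynamicLimit.Theorems.ChaosClosesEulerStressIsotropy (MpsiC MpsiC_eq_sum sqTail)

variable {N : ℕ}

/-! ## §1 The cone law -/

/-- **The `x`-cone velocity law** of a configuration: `Σᵢ (N+1)⁻¹ b_r(xᵢ, x) δ_{vᵢ}`, a finite measure on `V3` of mass
`ρ_r(x)`. [folklore] -/
def coneLaw (r : ℝ) (w : Phase N) (x : T3) : Measure V3 :=
  ∑ i : Fin (N + 1), ENNReal.ofReal (((N + 1 : ℕ) : ℝ)⁻¹ * cone r (w i).1 x) • Measure.dirac (w i).2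

/-- The cone law on a set. [folklore] -/
theorem coneLaw_apply (r : ℝ) (w : Phase N) (x : T3) (s : Set V3) :
    coneLaw r w x s = ∑ i : Fin (N + 1), ENNReal.ofReal (((N + 1 : ℕ) : ℝ)⁻¹ * cone r (w i).1 x) * Measure.dirac (w i).2 s := by
  simp only [coneLaw, Measure.coe_finsetSum, Finset.sum_apply, Measure.smul_apply, smul_eq_mul]

/-- The cone law is a finite measure. [folklore] -/
instance isFiniteMeasure_coneLaw (r : ℝ) (w : Phase N) (x : T3) : IsFiniteMeasure (coneLaw r w x) := by
  refine ⟨?_⟩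
  rw [coneLaw_apply]
  exact ENNReal.sum_lt_top.2 fun i _ => ENNReal.mul_lt_top ENNReal.ofReal_lt_top (measure_lt_top _ _)

/-- Every function is integrable against the cone law (a finite sum of Dirac masses). [folklore] -/
theorem integrable_coneLaw (r : ℝ) (w : Phase N) (x : T3) (f : V3 → ℝ) : Integrable f (coneLaw r w x) := by
  unfold coneLaw
  exact integrable_finsetSum_measure.2 fun i _ => (integrable_dirac (by simp)).smul_measure ENNReal.ofReal_ne_top

/-- **Integration against the cone law** (vector-valued): `∫ f = Σᵢ ((N+1)⁻¹ b_r(xᵢ, x)) • f(vᵢ)` (`0 < r`). [folklore] -/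
theorem integral_coneLaw {E : Type*} [NormedAddCommGroup E] [NormedSpace ℝ E] [CompleteSpace E] {r : ℝ} (hr : 0 < r)
    (w : Phase N) (x : T3) (f : V3 → E) :
    ∫ v, f v ∂coneLaw r w x = ∑ i : Fin (N + 1), (((N + 1 : ℕ) : ℝ)⁻¹ * cone r (w i).1 x) • f (w i).2 := by
  unfold coneLaw
  rw [integral_finsetSum_measure fun i _ => (integrable_dirac (by simp)).smul_measure ENNReal.ofReal_ne_top]
  refine Finset.sum_congr rfl fun i _ => ?_
  rw [integral_smul_measure, integral_dirac, ENNReal.toReal_ofReal (mul_nonneg (by positivity) (cone_nonneg hr _ _))]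

/-- **Integration against the cone law is the cone-weighted empirical average.** [folklore] -/
theorem integral_coneLaw_real {r : ℝ} (hr : 0 < r) (w : Phase N) (x : T3) (f : V3 → ℝ) :
    ∫ v, f v ∂coneLaw r w x = ∫ q, cone r q.1 x * f q.2 ∂(empiricalMeasure w) := by
  rw [integral_coneLaw hr, integral_empiricalMeasure, Finset.mul_sum]
  refine Finset.sum_congr rfl fun i _ => ?_
  rw [smul_eq_mul]; ring

/-- The mass of the cone law is `ρ_r(x)`. [folklore] -/
theorem coneLaw_univ_toReal {r : ℝ} (hr : 0 < r) (w : Phase N) (x : T3) : (coneLaw r w x univ).toReal = rhoC r w x := by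
  have h := integral_coneLaw_real hr w x (fun _ => (1 : ℝ))
  rw [integral_const, smul_eq_mul, mul_one, measureReal_def] at h
  rw [h]; simp only [mul_one]; rfl

/-- The `ψ`-moment of the cone law is `MpsiC`. [folklore] -/
theorem integral_coneLaw_psi {r : ℝ} (hr : 0 < r) (w : Phase N) (x : T3) (ψ : V3 → ℝ) :
    ∫ v, ψ v ∂coneLaw r w x = MpsiC r w x ψ := integral_coneLaw_real hr w x ψ

/-- The kinetic energy of the cone law is `kinC`. [folklore] -/
theorem integral_coneLaw_sq_half {r : ℝ} (hr : 0 < r) (w : Phase N) (x : T3) :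
    ∫ v, ‖v‖ ^ 2 / 2 ∂coneLaw r w x = kinC r w x := integral_coneLaw_real hr w x _

/-- The momentum of the cone law is `momC`. [folklore] -/
theorem integral_coneLaw_id {r : ℝ} (hr : 0 < r) (w : Phase N) (x : T3) : ∫ v, v ∂coneLaw r w x = momC r w x := by
  rw [integral_coneLaw hr, momC_eq_sum, Finset.smul_sum]
  exact Finset.sum_congr rfl fun i _ => by rw [smul_smul]

/-- The `δ`-mollification of the cone law is the `gC` of helper A. [folklore] -/
theorem integral_coneLaw_phi {r : ℝ} (hr : 0 < r) (w : Phase N) (x : T3) (δ : ℝ) (v : V3) :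
    ∫ w', localMaxwellian 1 (δ ^ 2) 0 (v - w') ∂coneLaw r w x = gC r δ w x v := integral_coneLaw_real hr w x _

/-- The quadratic tails of the cone law are the `ψ`-moments of `sqTail`. [folklore] -/
theorem setIntegral_coneLaw_tail {r : ℝ} (hr : 0 < r) (w : Phase N) (x : T3) (M : ℝ) :
    ∫ v in {v : V3 | M < ‖v‖}, ‖v‖ ^ 2 ∂coneLaw r w x = MpsiC r w x (sqTail M) := by
  rw [← integral_indicator (measurableSet_lt measurable_const measurable_norm), integral_coneLaw_real hr]; rfl

/-! ## §2 `DissipationRigidity` on the cone law -/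

/-- **`DissipationRigidity` applied to the cone law.** Given the hypothesis `DissipationRigidity` of the statement
(VERBATIM), for every modulus `Lt`, cut-offs `ρ₁, θ₁ > 0`, `ρ₂`, bounded continuous `ψ`, coarse-graining `δ > 0` and
`ε > 0` there are `η > 0`, `K₁`, then `L₁(K)`, then `n(K, L)` such that for EVERY particle number, cone scale `r > 0`,
configuration `w` and centre `x` in the class (`ρ₁ ≤ ρ_r(x) ≤ ρ₂`, cone tails `MpsiC (sqTail (Lt j)) ≤ 1/(j+1)` for
`j ≤ n`, `θ_r(x) ≥ θ₁`) a small cut dissipation `DissC r δ K L w x ≤ η` of the smoothed cone law gives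
`|MpsiC ψ − ρ_r ∫ ψ M_{1,θ_r,u_r}| ≤ ε` (the `let`s of `DissipationRigidity` on `m := coneLaw r w x` are DEFINITIONALLY
`gC`, `LamC`, `DissC`, `rhoC`, `uC`, `thetaC`). [folklore] -/
theorem dr_coneLaw
    (hDR : ∀ (Lt : ℕ → ℝ) (ρ₁ ρ₂ θ₁ : ℝ), 0 < ρ₁ → 0 < θ₁ →
        ∀ ψ : V3 → ℝ, Continuous ψ → (∃ C : ℝ, ∀ v, |ψ v| ≤ C) → ∀ δ : ℝ, 0 < δ → ∀ ε : ℝ, 0 < ε →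
        ∃ η : ℝ, 0 < η ∧ ∃ K₁ : ℝ, ∀ K : ℝ, K₁ ≤ K → ∃ L₁ : ℝ, ∀ L : ℝ, L₁ ≤ L → ∃ n : ℕ,
        ∀ m : Measure V3, IsFiniteMeasure m → Integrable (fun v : V3 => ‖v‖ ^ 2) m →
          ρ₁ ≤ (m Set.univ).toReal → (m Set.univ).toReal ≤ ρ₂ →
          (∀ j : ℕ, j ≤ n → ∫ v in {v : V3 | Lt j < ‖v‖}, ‖v‖ ^ 2 ∂m ≤ 1 / ((j : ℝ) + 1)) →
        let φδ : V3 → ℝ := fun v => localMaxwellian 1 (δ ^ 2) 0 v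
        let y₀ : V3 → ℝ := fun v => Real.exp (-K) * ((1 + ‖v‖ ^ 2) ^ 2)⁻¹
        let ℓK : V3 → ℝ → ℝ := fun v y => if y₀ v ≤ y then Real.log y else Real.log (y₀ v) + (y - y₀ v) / y₀ v
        let g : V3 → ℝ := fun v => ∫ w, φδ (v - w) ∂m
        let Λt : V3 → ℝ := fun v => ∫ u, φδ (v - u) * ℓK u (g u)
        let Gt : V3 → ℝ := fun v => Real.exp (Λt v)
        let cut : V3 → V3 → ℝ := fun v u => if ‖v‖ ^ 2 + ‖u‖ ^ 2 ≤ L then 1 else 0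
        let D : ℝ := ∫ v, ∫ u, cut v u * (∫ ω : Metric.sphere (0 : V3) 1,
            (Λt v + Λt u - Λt (collide ω (v, u)).1 - Λt (collide ω (v, u)).2) * hardSphereKernel (u, v) ω
              ∂sphereMeasure) * (Gt v * Gt u)
        let ρm : ℝ := (m Set.univ).toReal
        let um : V3 := ρm⁻¹ • ∫ v, v ∂m
        let θm : ℝ := 2 / 3 * ((∫ v, ‖v‖ ^ 2 / 2 ∂m) / ρm - ‖∫ v, v ∂m‖ ^ 2 / (2 * ρm ^ 2))
        θ₁ ≤ θm → D ≤ η → |(∫ v, ψ v ∂m) - ρm * ∫ v, ψ v * localMaxwellian 1 θm um v| ≤ ε)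
    (Lt : ℕ → ℝ) {ρ₁ ρ₂ θ₁ : ℝ} (hρ₁ : 0 < ρ₁) (hθ₁ : 0 < θ₁) (ψ : V3 → ℝ) (hψ : Continuous ψ)
    (hψb : ∃ C : ℝ, ∀ v, |ψ v| ≤ C) {δ : ℝ} (hδ : 0 < δ) {ε : ℝ} (hε : 0 < ε) :
    ∃ η : ℝ, 0 < η ∧ ∃ K₁ : ℝ, ∀ K : ℝ, K₁ ≤ K → ∃ L₁ : ℝ, ∀ L : ℝ, L₁ ≤ L → ∃ n : ℕ,
      ∀ (N : ℕ) (r : ℝ), 0 < r → ∀ (w : Phase N) (x : T3), ρ₁ ≤ rhoC r w x → rhoC r w x ≤ ρ₂ →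
        (∀ j : ℕ, j ≤ n → MpsiC r w x (sqTail (Lt j)) ≤ 1 / ((j : ℝ) + 1)) →
        θ₁ ≤ thetaC r w x → DissC r δ K L w x ≤ η →
        |MpsiC r w x ψ - rhoC r w x * ∫ v, ψ v * localMaxwellian 1 (thetaC r w x) (uC r w x) v| ≤ ε := by
  obtain ⟨η, hη, K₁, hK⟩ := hDR Lt ρ₁ ρ₂ θ₁ hρ₁ hθ₁ ψ hψ hψb δ hδ ε hε
  refine ⟨η, hη, K₁, fun K hKK => ?_⟩
  obtain ⟨L₁, hL⟩ := hK K hKK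
  refine ⟨L₁, fun L hLL => ?_⟩
  obtain ⟨n, hn⟩ := hL L hLL
  refine ⟨n, fun N r hr w x hρ1 hρ2 htail hθ hD => ?_⟩
  have hm1 : ρ₁ ≤ (coneLaw r w x Set.univ).toReal := by rwa [coneLaw_univ_toReal hr]
  have hm2 : (coneLaw r w x Set.univ).toReal ≤ ρ₂ := by rwa [coneLaw_univ_toReal hr]
  have hm3 : ∀ j : ℕ, j ≤ n → ∫ v in {v : V3 | Lt j < ‖v‖}, ‖v‖ ^ 2 ∂coneLaw r w x ≤ 1 / ((j : ℝ) + 1) :=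
    fun j hj => by rw [setIntegral_coneLaw_tail hr]; exact htail j hj
  have h := hn (coneLaw r w x) inferInstance (integrable_coneLaw r w x _) hm1 hm2 hm3
  -- every real integral against the cone law becomes a cone `ψ`-moment (`kinC`, `gC` are such moments DEFINITIONALLY)
  simp only [coneLaw_univ_toReal hr, integral_coneLaw_psi hr, integral_coneLaw_id hr] at h
  exact h hθ hD

/-! ## §3 The cut functionals of the smoothed cone law -/

/-- The unit sphere of velocity space (local notation). -/
local notation "S2" => Metric.sphere (0 : V3) 1

/-- The bound of `Λ̃_x` on the pair-energy ball `{‖v‖² ≤ L}`: `A(K, δ, ρ̄) + 2 max(L, 0)` when `ρ_r(x) ≤ ρ̄`. [folklore] -/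
theorem abs_LamC_le_on_ball {r : ℝ} (hr : 0 < r) {δ : ℝ} (hδ : 0 < δ) (K L : ℝ) (w : Phase N) (x : T3) {ρb : ℝ}
    (hρ : rhoC r w x ≤ ρb) : ∀ v : V3, ‖v‖ ^ 2 ≤ L → |LamC r δ K w x v| ≤ ALam K δ ρb + 2 * max L 0 :=
  fun v hv => (abs_LamC_le hr hδ K w x hρ v).trans (by linarith [le_max_left L 0])

/-- The ball bound is nonnegative. [folklore] -/
theorem ALam_add_nonneg (K δ L : ℝ) {ρb : ℝ} (hρb : 0 ≤ ρb) : 0 ≤ ALam K δ ρb + 2 * max L 0 :=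
  add_nonneg (ALam_nonneg K δ hρb) (mul_nonneg zero_le_two (le_max_right _ _))

/-- **`𝒫(w, x) ≥ 0`**: the cut Enskog prediction of the smoothed cone law is nonnegative (Boltzmann's inequality,
helper B, with the log-growth bound of helper A). [folklore] -/
theorem PredC_nonneg {r : ℝ} (hr : 0 < r) {δ : ℝ} (hδ : 0 < δ) (K L : ℝ) (w : Phase N) (x : T3) :
    0 ≤ PredC r δ K L w x :=
  predF_nonneg (measurable_LamC_v r δ K w x) (ALam_add_nonneg K δ L (rhoC_nonneg hr w x))
    (abs_LamC_le_on_ball hr hδ K L w x le_rfl)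

/-- **`D = 2𝒫` on the smoothed cone law.** [folklore] -/
theorem DissC_eq_two_mul_PredC {r : ℝ} (hr : 0 < r) {δ : ℝ} (hδ : 0 < δ) (K L : ℝ) (w : Phase N) (x : T3) :
    DissC r δ K L w x = 2 * PredC r δ K L w x :=
  dissF_eq_two_mul_predF (measurable_LamC_v r δ K w x) (ALam_add_nonneg K δ L (rhoC_nonneg hr w x))
    (abs_LamC_le_on_ball hr hδ K L w x le_rfl)

/-- **`|𝒫(w, x)| ≤ predBound L (A + 2 max(L,0))` when `ρ_r(x) ≤ ρ̄`** — a bound uniform in the configuration.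
[folklore] -/
theorem abs_PredC_le {r : ℝ} (hr : 0 < r) {δ : ℝ} (hδ : 0 < δ) (K L : ℝ) (w : Phase N) (x : T3) {ρb : ℝ}
    (hρ : rhoC r w x ≤ ρb) : |PredC r δ K L w x| ≤ predBound L (ALam K δ ρb + 2 * max L 0) :=
  abs_predF_le (measurable_LamC_v r δ K w x) (ALam_add_nonneg K δ L ((rhoC_nonneg hr w x).trans hρ))
    (abs_LamC_le_on_ball hr hδ K L w x hρ)

/-- The sphere integral `Θ_x(v, u) = ∫ [Λ̃(v) − Λ̃(v′)] ((u−v)·ω)₊ dω` is measurable along measurable data, jointly in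
`((a, v), u)`. [folklore] -/
theorem measurable_ThetaC_comp (r δ K : ℝ) {α : Type*} [MeasurableSpace α] {W : α → Phase N} {X : α → T3}
    (hW : Measurable W) (hX : Measurable X) :
    Measurable fun p : (α × V3) × V3 => ∫ ω : S2,
      (LamC r δ K (W p.1.1) (X p.1.1) p.1.2 - LamC r δ K (W p.1.1) (X p.1.1) (collide ω (p.1.2, p.2)).1) *
        hardSphereKernel (p.2, p.1.2) ω ∂sphereMeasure := by
  have hW3 : Measurable fun q : ((α × V3) × V3) × S2 => W q.1.1.1 := hW.comp measurable_fst.fst.fst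
  have hX3 : Measurable fun q : ((α × V3) × V3) × S2 => X q.1.1.1 := hX.comp measurable_fst.fst.fst
  have hvu : Measurable fun q : ((α × V3) × V3) × S2 => ((q.1.1.2, q.1.2), q.2) :=
    (measurable_fst.fst.snd.prodMk measurable_fst.snd).prodMk measurable_snd
  have hcol : Measurable fun q : ((α × V3) × V3) × S2 => (collide q.2 (q.1.1.2, q.1.2)).1 :=
    ((measurable_collide_q.comp hvu).fst :)
  have hk : Measurable fun q : ((α × V3) × V3) × S2 => hardSphereKernel (q.1.2, q.1.1.2) q.2 :=
    (continuous_hsk.measurable.comp hvu :)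
  have hL1 : Measurable fun q : ((α × V3) × V3) × S2 => LamC r δ K (W q.1.1.1) (X q.1.1.1) q.1.1.2 :=
    measurable_LamC_comp r δ K hW3 hX3 measurable_fst.fst.snd
  have hL2 : Measurable fun q : ((α × V3) × V3) × S2 => LamC r δ K (W q.1.1.1) (X q.1.1.1) (collide q.2 (q.1.1.2, q.1.2)).1 :=
    measurable_LamC_comp r δ K hW3 hX3 hcol
  have h3 : Measurable fun q : ((α × V3) × V3) × S2 =>
      (LamC r δ K (W q.1.1.1) (X q.1.1.1) q.1.1.2 - LamC r δ K (W q.1.1.1) (X q.1.1.1) (collide q.2 (q.1.1.2, q.1.2)).1) *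
        hardSphereKernel (q.1.2, q.1.1.2) q.2 := (hL1.sub hL2).mul hk
  exact (h3.stronglyMeasurable.integral_prod_right' (ν := (sphereMeasure : Measure S2))).measurable

/-- The integrand of `𝒫` is measurable along measurable data, jointly in `((a, v), u)`. [folklore] -/
theorem measurable_predIntegrand_comp (r δ K L : ℝ) {α : Type*} [MeasurableSpace α] {W : α → Phase N} {X : α → T3}
    (hW : Measurable W) (hX : Measurable X) :
    Measurable fun p : (α × V3) × V3 => cutL L p.1.2 p.2 * (∫ ω : S2,
      (LamC r δ K (W p.1.1) (X p.1.1) p.1.2 - LamC r δ K (W p.1.1) (X p.1.1) (collide ω (p.1.2, p.2)).1) *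
        hardSphereKernel (p.2, p.1.2) ω ∂sphereMeasure) *
      (Real.exp (LamC r δ K (W p.1.1) (X p.1.1) p.1.2) * Real.exp (LamC r δ K (W p.1.1) (X p.1.1) p.2)) := by
  have hW2 : Measurable fun p : (α × V3) × V3 => W p.1.1 := hW.comp measurable_fst.fst
  have hX2 : Measurable fun p : (α × V3) × V3 => X p.1.1 := hX.comp measurable_fst.fst
  have hLv : Measurable fun p : (α × V3) × V3 => LamC r δ K (W p.1.1) (X p.1.1) p.1.2 :=
    measurable_LamC_comp r δ K hW2 hX2 measurable_fst.snd
  have hLu : Measurable fun p : (α × V3) × V3 => LamC r δ K (W p.1.1) (X p.1.1) p.2 :=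
    measurable_LamC_comp r δ K hW2 hX2 measurable_snd
  have hcut : Measurable fun p : (α × V3) × V3 => cutL L p.1.2 p.2 :=
    ((measurable_cutL L).comp (measurable_fst.snd.prodMk measurable_snd) :)
  exact (hcut.mul (measurable_ThetaC_comp r δ K hW hX)).mul (hLv.exp.mul hLu.exp)

/-- **`𝒫` is measurable along measurable data**: for measurable `W : α → Phase N`, `X : α → T3`,
`a ↦ 𝒫(W a, X a)` is measurable (three nested parametric integrals of jointly measurable integrands). [folklore] -/
theorem measurable_PredC_comp (r δ K L : ℝ) {α : Type*} [MeasurableSpace α] {W : α → Phase N} {X : α → T3}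
    (hW : Measurable W) (hX : Measurable X) : Measurable fun a => PredC r δ K L (W a) (X a) := by
  have hI2 : Measurable fun p : α × V3 => ∫ u : V3, cutL L p.2 u * (∫ ω : S2,
      (LamC r δ K (W p.1) (X p.1) p.2 - LamC r δ K (W p.1) (X p.1) (collide ω (p.2, u)).1) *
        hardSphereKernel (u, p.2) ω ∂sphereMeasure) *
      (Real.exp (LamC r δ K (W p.1) (X p.1) p.2) * Real.exp (LamC r δ K (W p.1) (X p.1) u)) :=
    ((measurable_predIntegrand_comp r δ K L hW hX).stronglyMeasurable.integral_prod_right'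
      (ν := (volume : Measure V3))).measurable
  have hI1 : Measurable fun a : α => ∫ v : V3, ∫ u : V3, cutL L v u * (∫ ω : S2,
      (LamC r δ K (W a) (X a) v - LamC r δ K (W a) (X a) (collide ω (v, u)).1) *
        hardSphereKernel (u, v) ω ∂sphereMeasure) *
      (Real.exp (LamC r δ K (W a) (X a) v) * Real.exp (LamC r δ K (W a) (X a) u)) :=
    (hI2.stronglyMeasurable.integral_prod_right' (ν := (volume : Measure V3))).measurable
  exact hI1

/-- `𝒫` along a measurable curve of configurations is jointly measurable in `(s, x)`. [folklore] -/
theorem measurable_PredC_orbit (r δ K L : ℝ) {γ : ℝ → Phase N} (hγ : Measurable γ) :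
    Measurable fun p : ℝ × T3 => PredC r δ K L (γ p.1) p.2 :=
  measurable_PredC_comp r δ K L (hγ.comp measurable_fst) measurable_snd

/-! ## §3 Registered sub-goal -/

/-- **Registered sub-goal `stub_localEquilibriumFromDissipationC` (helper C of `stub_localEquilibriumFromDissipation`):
integration against the cone law is the cone-weighted empirical average.** [folklore] -/
theorem stub_localEquilibriumFromDissipationC : ∀ {N : ℕ} {r : ℝ}, 0 < r → ∀ (w : Config (N + 1) (Fin 3) T3) (x : T3) (f : V3 → ℝ), ∫ v, f v ∂(∑ i : Fin (N + 1), ENNReal.ofReal (((N + 1 : ℕ) : ℝ)⁻¹ * cone r (w i).1 x) • Measure.dirac (w i).2) = ∫ q, cone r q.1 x * f q.2 ∂(empiricalMeasure w) :=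
  fun hr w x f => integral_coneLaw_real hr w x f

end Summit.AtomisticToContinuum.HydrodynamicLimit.Theorems.ChaosClosesEulerLocalEquilibriumFromDissipation

end
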